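import Summits.MatrixMultiplication.MatrixMultiplication.Theorems.AbelianSTPPCensusFPQCycDefs

/-!
# Rule FPq of the abelian STPP census with an ARBITRARY finite abelian label group `Λ` (`FPQ.AdmG`)

Cell mm-stpp (rung F-M1), theory lane «past the walls» (seat mm-stpp-theory, gen 18).  Definitions only (no checker, no claim).

`AbelianSTPPCensusFPQCycDefs` indexes the classes of a prime-order subgroup `P ≤ H` by the CYCLIC group `ℤ/q` (sound whenever `q` is
squarefree).  When `q = |H|/p` is not squarefree the quotient `H ⧸ P` need not be cyclic — `q = 4`: `ℤ/4` or `ℤ/2 × ℤ/2` (rule FP4's two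
tables), `q = 25` (`7675 = 25·307`): `ℤ/25` or `(ℤ/5)²`, `q = 64` (`832 = 64·13`): eleven groups.  This file states the same shape-level
predicate with the classes indexed by ANY finite abelian group `Λ` (the label group): `FPQ.TargetOKG`, `FPQ.FormOKG`, `FPQ.AdmG Λ M a b c`.
Soundness (`AbelianSTPPCensusFPQGenSound`): every STPP family in a finite abelian `H` that has a subgroup `P` of prime order `p` with
`H ⧸ P ≃+ Λ` satisfies `AdmG Λ |H|`; a kill at an order `M = |Λ|·p` therefore needs one certificate `¬ AdmG Λᵢ M a b c` per abelian group `Λᵢ` of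
order `|Λ|` that occurs as such a quotient (all of them, absent further information).  `AdmC q` of `AbelianSTPPCensusFPQCycDefs` is the case
`Λ = ZMod q` (same clauses).
WHAT THIS IS NOT: no claim, no checker, no census number, no `ω` statement; vacuous unless `M = |Λ|·p` with `p` prime.
-/

set_option linter.dupNamespace false -- `MatrixMultiplication.MatrixMultiplication` (summit = problem, D-0017)
set_option autoImplicit false

namespace Summit.MatrixMultiplication.MatrixMultiplication.Theorems

open Finset

namespace FPQ

variable (Λ : Type) [AddCommGroup Λ] [Fintype Λ] [DecidableEq Λ]

/-- One TARGET CLASS `c ∈ Λ` of a letter form with classes indexed by the label group `Λ`: summand class counts `u, v` (pairs `(u_g, v_{c−g})`),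
`W` target points in class `c` with `r`-values in `[vmin, cap]`, cosets of size `p`: `W ≤ p`; (F1) the `|Λ|` Pollard floors at any admissible
levels jointly below `W·min(T, cap) + T·(p − W)`; (F2) mass; (F3) pointwise; (PH) pigeonhole (shape-level predicate, no claim). [original] -/
def TargetOKG (p cap vmin : ℕ) (u v : Λ → ℕ) (c : Λ) (W : ℕ) : Prop :=
  W ≤ p ∧
  (∀ τ : Λ → ℕ, (∀ g, τ g ≤ u g ∧ τ g ≤ v (c - g)) →
    ∑ g, FP2.pairFloor p (u g) (v (c - g)) (τ g) ≤ W * min (∑ g, τ g) cap + (∑ g, τ g) * (p - W)) ∧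
  vmin * W ≤ ∑ g, u g * v (c - g) ∧
  (1 ≤ W → vmin ≤ ∑ g, min (u g) (v (c - g))) ∧
  (1 ≤ W → ∑ g, (u g + v (c - g) - p) ≤ cap)

/-- One LETTER FORM `U + V → W′` with classes indexed by `Λ`: totals `SU, SV, SW`, summand classes of size `≤ p`, every target class `TargetOKG`
(shape-level predicate, no claim). [original] -/
def FormOKG (p cap vmin SU SV SW : ℕ) (u v w : Λ → ℕ) : Prop :=
  ∑ g, u g = SU ∧ ∑ g, v g = SV ∧ ∑ g, w g = SW ∧ (∀ g, u g ≤ p) ∧ (∀ g, v g ≤ p) ∧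
  ∀ c, TargetOKG Λ p cap vmin u v c (w c)

variable {N : ℕ}

/-- **Rule FPq with label group `Λ`, shape form.**  At an order `M = |Λ|·p` with `p` prime, for every choice of lower bounds `va ≤ a_i`,
`vb ≤ b_i`, `vc ≤ c_i`, there are class counts `x, y, z : Λ → ℕ` of `X = ⋃(B − A)`, `Y = ⋃(C − B)`, `Z′ = ⋃(C − A)` passing form B
(`X, Y → Z′`, values `b`), form A (`−Z′, X → −Y`, values `a`; counts of `−S` = counts of `S` at the negated labels) and form C (`Y, −Z′ → −X`,
values `c`).  Vacuous unless `M = |Λ|·p` with `p` prime.  Sound for the families in groups `H` with a subgroup `P` of order `p` and `H ⧸ P ≃+ Λ`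
(`FPQ.admG_of_isSTPP`, file `AbelianSTPPCensusFPQGenSound`).  No claim by itself. [original] -/
def AdmG (M : ℕ) (a b c : Fin N → ℕ) : Prop :=
  ∀ p : ℕ, M = Fintype.card Λ * p → p.Prime →
    ∀ va vb vc : ℕ, (∀ i, va ≤ a i) → (∀ i, vb ≤ b i) → (∀ i, vc ≤ c i) →
      ∃ x y z : Λ → ℕ,
        FormOKG Λ p (univ.sup b) vb (pAB a b c) (pBC a b c) (pCA a b c) x y z ∧
        FormOKG Λ p (univ.sup a) va (pCA a b c) (pAB a b c) (pBC a b c) (fun g => z (-g)) x (fun g => y (-g)) ∧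
        FormOKG Λ p (univ.sup c) vc (pBC a b c) (pCA a b c) (pAB a b c) y (fun g => z (-g)) (fun g => x (-g))

/-- The cyclic rule is the case `Λ = ℤ/q`: `AdmC q M a b c ↔ AdmG (ZMod q) M a b c` (same clauses; `|ℤ/q| = q`). [bookkeeping] -/
theorem admC_iff_admG (q : ℕ) [NeZero q] (M : ℕ) (a b c : Fin N → ℕ) : AdmC q M a b c ↔ AdmG (ZMod q) M a b c := by
  unfold AdmC AdmG FormOKG FormOKC TargetOKG TargetOKC
  rw [ZMod.card q]

end FPQ

end Summit.MatrixMultiplication.MatrixMultiplication.Theorems
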